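import Literature.AlgebraicGeometry.Crystalline.HuComplexesTruncated
import Literature.AlgebraicGeometry.KTheory.HuInfinitesimalKZeroProofs
import Literature.Algebra.Homology.TorsionFreeLimitFamily
import Literature.Algebra.Homology.StupidFiltrationDegeneration
import HarnessLib

/-!
# Criteria for the two lattice lemmas on the hypercohomology of X. Hu's complexes

For a smooth proper `𝒳/W(k)` the crux `FormalLiftingFromClassLifting` of route
`HodgeConjecture/PadicSemiregularLift` is, modulo X. Hu's two named facts
(`KTheory/HuInfinitesimalKZero`, arXiv:2507.12458), the conjunction of two LATTICE LEMMAS on the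
groups `huH p k 𝒳 r 1 n i = ℍⁱ(|𝒳|, p^{r,1}_{r,n}Ω•)` and Hu's reductions `huHReduce`
(Summits-side: `…HuReduction.lean`, hypotheses `hL1`, `hL2`):

* (L1) the transitions `HuKernelSource.reduce 1 (N+2 ≤ N+3)` (`⊕_{r<p} ℍ^{2r-1}`) are onto;
* (L2) on `N ↦ HuObstructionTarget p k 𝒳 d 1 (N+2)` (`⊕_{r<d} ℍ^{2r}`) every compatible family
  killed by a non-zero integer vanishes.

This file derives BOTH from statements about the hypercohomology
`staircaseH p k 𝒳 r M i = ℍⁱ(|𝒳|, σ≤(r-1) p^{(r-•)M}Ω•)` of the TRUNCATED STAIRCASE DE RHAM COMPLEXES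
(`Crystalline/HuComplexesTruncated.deRhamStaircaseTrunc`; columns `𝒪, Ω¹, …, Ω^{r-1}` only;
functoriality of Hu's reductions from `KTheory/HuInfinitesimalKZeroProofs`),
through the truncated presentation `0 → σ≤(r-1) p^{(r-•)N}Ω• → σ≤(r-1) p^{(r-•)M}Ω• → σ≤(r-1)
p^{r,M}_{r,N}Ω• ≅ p^{r,M}_{r,N}Ω• → 0` (`huPresentationTrunc_shortExact`) and the retraction
identities `incl ≫ μ = μ ≫ incl = p^{rN}` (`deRhamStaircaseTruncLE_comp_ι_comp_retraction`,
`deRhamStaircaseTruncι_comp_retraction_comp_LE`):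

* `staircaseHLE_injective_of_torsionFree` — if `ℍⁱ(σ≤ p^{(r-•)N}Ω•)` has no `p`-torsion, the
  inclusion-induced `ℍⁱ(σ≤ p^{(r-•)N}Ω•) → ℍⁱ(σ≤ p^{(r-•)M}Ω•)` (`M ≤ N`) is injective;
* `staircaseHπ_surjective` — if that holds in degree `i + 1`, the projection
  `staircaseHπ : ℍⁱ(σ≤ p^{(r-•)M}Ω•) → ℍⁱ(p^{r,M}_{r,N}Ω•)` is onto (long exact sequence), whence
  (`huHReduce_surjective_of_torsionFree`) Hu's reductions `ℍⁱ(p^{r,M}_{r,N'}) → ℍⁱ(p^{r,M}_{r,N})`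
  (`N ≤ N'`) are onto; **(L1)**: `huKernelSource_reduce_surjective_of_torsionFree` — (L1) holds as
  soon as every `ℍ^{2r}(σ≤(r-1) p^{(r-•)(N+2)}Ω•)` (`1 ≤ r < p`, `N ≥ 0`) has no `p`-torsion;
* **(L2)**: `huObstructionTarget_family_eq_zero` — (L2) holds as soon as, for `1 ≤ r < d`,
  (i) `ℍ^{2r}(σ≤(r-1) p^{(r-•)}Ω•)` has no `p`-torsion, (ii) every `ℍ^{2r+1}(σ≤(r-1) p^{(r-•)(N+2)}Ω•)`
  has no `p`-torsion, and (iii) the image of `ℍ^{2r}(σ≤ p^{(r-•)(N+2)}Ω•) → ℍ^{2r}(σ≤ p^{(r-•)}Ω•)` is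
  divisible by `p^{N+1}` (chain level: the inclusion of truncated staircases is `p^{N+1}` times a
  chain map); the proof is the `p`-adic algebra of `Algebra/Homology/TorsionFreeLimitFamily`
  on `H = ℍ^{2r}(σ≤ p^{(r-•)}Ω•)` with `p^{r(N+2)} H ⊆ I_{N+2} ⊆ p^{N+1} H`.

So the inputs left for the line are torsion-freeness statements about `ℍᵏ(σ≤(r-1) p^{(r-•)M}Ω•)`
— which follow from the torsion-freeness of the columns `Hᵇ(𝒳, Ωʲ)`, `j ≤ r - 1`, and the
degeneration of the Hodge–de Rham spectral sequence modulo torsion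
(`Crystalline.HodgeDeRhamDegeneratesModTorsion`, `Algebra/Homology/StupidFiltrationDegeneration`)
— and the divisibility (iii). [folklore] Everything is proved; no named facts.
-/

noncomputable section

-- hyper-Ext smallness instances for the truncated / extended complexes go through
-- `IsStrictlyGE 0 ⇒ IsGE 0`; give the search some room (as in `Crystalline/HodgeDeRhamDegeneration`).
set_option synthInstance.maxHeartbeats 200000

namespace Literature.AlgebraicGeometry.KTheory.HuStaircase

open CategoryTheory CategoryTheory.Limits _root_.AlgebraicGeometry _root_.TopologicalSpace
  Literature.AlgebraicGeometry.Motives Literature.AlgebraicGeometry.Crystalline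
  Literature.Algebra.Homology Literature.AlgebraicGeometry.KTheory

section Staircase

variable (p : ℕ) [Fact p.Prime] (k : Type) [CommRing k] (𝒳 : SchemeOver (WittVector p k))

/-! ### Hypercohomology of the truncated staircase de Rham complexes -/

/-- `ℍⁱ(|𝒳|, σ≤(r-1) p^{(r-•)M}Ω•)`: the hypercohomology (`Crystalline.SheafHypercohomology`, on
`|𝒳|`, Zariski) of the truncated staircase de Rham complex
`[p^{rM}𝒪 → p^{(r-1)M}Ω¹ → ⋯ → p^{M}Ω^{r-1}]` (`Crystalline.deRhamStaircaseTrunc`). [folklore] -/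
abbrev staircaseH (r M : ℕ) (i : ℤ) : Type :=
  SheafHypercohomology.{0} (Opens.grothendieckTopology 𝒳.left) (deRhamStaircaseTrunc 𝒳 (p : ℤ) r M) i

/-- The map `ℍⁱ(σ≤ p^{(r-•)M'}Ω•) → ℍⁱ(σ≤ p^{(r-•)M}Ω•)` induced by the inclusion (`M ≤ M'`).
[folklore] -/
abbrev staircaseHLE (r : ℕ) {M M' : ℕ} (h : M ≤ M') (i : ℤ) :
    staircaseH p k 𝒳 r M' i →+ staircaseH p k 𝒳 r M i :=
  HyperExt.map (deRhamStaircaseTruncLE 𝒳 (p : ℤ) r h) i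

/-- The map `μ : ℍⁱ(σ≤ p^{(r-•)M}Ω•) → ℍⁱ(σ≤ p^{(r-•)N}Ω•)` induced by `σ(ι_M) ≫ σ(ψ_N)` (inclusion into
`σ≤ Ω•` followed by the staircase retraction): inverse to the inclusion-induced map up to `p^{rN}`.
[folklore] -/
abbrev staircaseHμ (r M N : ℕ) (i : ℤ) : staircaseH p k 𝒳 r M i →+ staircaseH p k 𝒳 r N i :=
  HyperExt.map (deRhamStaircaseTruncι 𝒳 (p : ℤ) r M ≫ deRhamStaircaseTruncRetraction 𝒳 (p : ℤ) r N) i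

/-- `μ ∘ incl = p^{rN}` on `ℍⁱ(σ≤ p^{(r-•)N}Ω•)` (`M ≤ N`). [folklore] -/
theorem staircaseHμ_staircaseHLE (r : ℕ) {M N : ℕ} (h : M ≤ N) (i : ℤ) (x : staircaseH p k 𝒳 r N i) :
    staircaseHμ p k 𝒳 r M N i (staircaseHLE p k 𝒳 r h i x) = ((p : ℤ) ^ (r * N)) • x := by
  rw [← HyperExt.map_comp, deRhamStaircaseTruncLE_comp_ι_comp_retraction, HyperExt.map_zsmul_id]

/-- `incl ∘ μ = p^{rN}` on `ℍⁱ(σ≤ p^{(r-•)M}Ω•)` (`M ≤ N`): `p^{rN} • ℍⁱ(σ≤ p^{(r-•)M}) ⊆ im(incl)`.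
[folklore] -/
theorem staircaseHLE_staircaseHμ (r : ℕ) {M N : ℕ} (h : M ≤ N) (i : ℤ) (y : staircaseH p k 𝒳 r M i) :
    staircaseHLE p k 𝒳 r h i (staircaseHμ p k 𝒳 r M N i y) = ((p : ℤ) ^ (r * N)) • y := by
  rw [← HyperExt.map_comp, Category.assoc, deRhamStaircaseTruncι_comp_retraction_comp_LE,
    HyperExt.map_zsmul_id]

/-- The inclusion-induced maps compose. [folklore] -/
theorem staircaseHLE_staircaseHLE (r : ℕ) {M M' M'' : ℕ} (h : M ≤ M') (h' : M' ≤ M'') (i : ℤ)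
    (x : staircaseH p k 𝒳 r M'' i) :
    staircaseHLE p k 𝒳 r h i (staircaseHLE p k 𝒳 r h' i x) = staircaseHLE p k 𝒳 r (h.trans h') i x := by
  rw [← HyperExt.map_comp, deRhamStaircaseTruncLE_comp]

/-- **Injectivity from torsion-freeness**: if `ℍⁱ(σ≤(r-1) p^{(r-•)N}Ω•)` has no `p`-torsion then
the inclusion-induced map `ℍⁱ(σ≤ p^{(r-•)N}Ω•) → ℍⁱ(σ≤ p^{(r-•)M}Ω•)` (`M ≤ N`) is injective
(`μ ∘ incl = p^{rN}`). [folklore] -/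
theorem staircaseHLE_injective_of_torsionFree (r : ℕ) {M N : ℕ} (h : M ≤ N) (i : ℤ)
    (htf : ∀ x : staircaseH p k 𝒳 r N i, (p : ℤ) • x = 0 → x = 0) :
    Function.Injective (staircaseHLE p k 𝒳 r h i) := by
  refine (injective_iff_map_eq_zero _).mpr fun x hx ↦ ?_
  apply eq_zero_of_pow_zsmul_eq_zero htf (r * N)
  rw [← staircaseHμ_staircaseHLE p k 𝒳 r h i x, hx, map_zero]

/-! ### The projection onto `ℍⁱ(p^{r,M}_{r,N}Ω•)` and the long exact sequence -/

/-- **The projection `ℍⁱ(σ≤(r-1) p^{(r-•)M}Ω•) → ℍⁱ(p^{r,M}_{r,N}Ω•) = huH p k 𝒳 r M N i`**: the map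
induced by the truncated projection `σ(q^{(r-•)M}Ω• → p^{r,M}_{r,N})` followed by the inverse of the
truncation isomorphism `p^{r,M}_{r,N} ⥲ σ≤(r-1) p^{r,M}_{r,N}`. [folklore] -/
abbrev staircaseHπ (r M N : ℕ) (i : ℤ) : staircaseH p k 𝒳 r M i →+ huH p k 𝒳 r M N i :=
  (HyperExt.map (inv (huComplexTruncπ 𝒳 (p : ℤ) r M N)) i).comp
    (HyperExt.map (stupidTruncLEMap (huComplexIntπ 𝒳 (p : ℤ) r M N) ((r : ℤ) - 1)) i)

/-- `π ∘ incl = 0`: the composite `ℍⁱ(σ≤ p^{(r-•)N}) → ℍⁱ(σ≤ p^{(r-•)M}) → ℍⁱ(p^{r,M}_{r,N})` vanishes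
(`M ≤ N`). [folklore] -/
theorem staircaseHπ_staircaseHLE (r : ℕ) {M N : ℕ} (h : M ≤ N) (i : ℤ)
    (x : staircaseH p k 𝒳 r N i) : staircaseHπ p k 𝒳 r M N i (staircaseHLE p k 𝒳 r h i x) = 0 := by
  have h0 : HyperExt.map (stupidTruncLEMap (huComplexIntπ 𝒳 (p : ℤ) r M N) ((r : ℤ) - 1)) i
      (staircaseHLE p k 𝒳 r h i x) = 0 :=
    HyperExt.map_comp_map_eq_zero (S := huPresentationTrunc 𝒳 (p : ℤ) r h) x
  rw [AddMonoidHom.comp_apply, h0, map_zero]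

/-- **Exactness at `ℍⁱ(σ≤ p^{(r-•)M}Ω•)`**: the kernel of the projection `π` onto `ℍⁱ(p^{r,M}_{r,N})`
is the image of `ℍⁱ(σ≤ p^{(r-•)N})` (`M ≤ N`). [folklore] -/
theorem exact_staircaseHLE_staircaseHπ (r : ℕ) {M N : ℕ} (h : M ≤ N) (i : ℤ) :
    Function.Exact (staircaseHLE p k 𝒳 r h i) (staircaseHπ p k 𝒳 r M N i) := by
  intro u
  refine ⟨fun hu ↦ ?_, ?_⟩
  · have hu' : HyperExt.map (stupidTruncLEMap (huComplexIntπ 𝒳 (p : ℤ) r M N) ((r : ℤ) - 1)) i u = 0 := by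
      apply (HyperExt.map_bijective_of_isIso (X := constantSheafInt (Opens.grothendieckTopology 𝒳.left))
        (inv (huComplexTruncπ 𝒳 (p : ℤ) r M N)) i).1
      rw [map_zero]
      exact hu
    exact ((HyperExt.exact₂_apply (constantSheafInt (Opens.grothendieckTopology 𝒳.left))
      (huPresentationTrunc_shortExact 𝒳 (p : ℤ) r h) i) u).mp hu'
  · rintro ⟨x, rfl⟩
    exact staircaseHπ_staircaseHLE p k 𝒳 r h i x

/-- **Surjectivity of the projection from injectivity one degree up**: if
`ℍ^{j}(σ≤ p^{(r-•)N}) → ℍ^{j}(σ≤ p^{(r-•)M})` is injective (`i + 1 = j`), then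
`π : ℍⁱ(σ≤ p^{(r-•)M}) → ℍⁱ(p^{r,M}_{r,N})` is onto (the connecting map followed by an injection is
zero on the image of `π`'s complement). [folklore] -/
theorem staircaseHπ_surjective (r : ℕ) {M N : ℕ} (h : M ≤ N) (i j : ℤ) (hij : i + 1 = j)
    (hinj : Function.Injective (staircaseHLE p k 𝒳 r h j)) :
    Function.Surjective (staircaseHπ p k 𝒳 r M N i) := by
  have hS := huPresentationTrunc_shortExact 𝒳 (p : ℤ) r h
  let Z := constantSheafInt (Opens.grothendieckTopology 𝒳.left)
  -- the truncated projection is onto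
  have hg : Function.Surjective
      (HyperExt.map (X := Z) (stupidTruncLEMap (huComplexIntπ 𝒳 (p : ℤ) r M N) ((r : ℤ) - 1)) i) := by
    intro y
    have hδ0 : staircaseHLE p k 𝒳 r h j (HyperExt.delta (X := Z) hS i j hij y) = 0 :=
      HyperExt.map_delta_eq_zero hS i j hij y
    have hδ : HyperExt.delta (X := Z) hS i j hij y = 0 :=
      hinj (hδ0.trans (map_zero (staircaseHLE p k 𝒳 r h j)).symm)
    exact ((HyperExt.exact₃_apply Z hS i j hij) y).mp hδ
  intro z
  obtain ⟨y, hy⟩ := (HyperExt.map_bijective_of_isIso (X := Z)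
    (inv (huComplexTruncπ 𝒳 (p : ℤ) r M N)) i).2 z
  obtain ⟨u, rfl⟩ := hg y
  exact ⟨u, hy⟩

/-- **Surjectivity of the projection from torsion-freeness one degree up.** [folklore] -/
theorem staircaseHπ_surjective_of_torsionFree (r : ℕ) {M N : ℕ} (h : M ≤ N) (i j : ℤ)
    (hij : i + 1 = j) (htf : ∀ x : staircaseH p k 𝒳 r N j, (p : ℤ) • x = 0 → x = 0) :
    Function.Surjective (staircaseHπ p k 𝒳 r M N i) :=
  staircaseHπ_surjective p k 𝒳 r h i j hij (staircaseHLE_injective_of_torsionFree p k 𝒳 r h j htf)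

/-! ### Compatibility with Hu's reductions -/

/-- **The projections are compatible with Hu's reductions**: `reduce ∘ π_{N'} = π_N` (`N ≤ N'`).
[folklore] -/
theorem huHReduce_staircaseHπ (r M : ℕ) {N N' : ℕ} (h' : N ≤ N') (i : ℤ)
    (u : staircaseH p k 𝒳 r M i) :
    huHReduce p k 𝒳 r M h' i (staircaseHπ p k 𝒳 r M N' i u) = staircaseHπ p k 𝒳 r M N i u := by
  have key : inv (huComplexTruncπ 𝒳 (p : ℤ) r M N') ≫ huComplexIntReduce 𝒳 (p : ℤ) r M h' =
      stupidTruncLEMap (huComplexIntReduce 𝒳 (p : ℤ) r M h') ((r : ℤ) - 1) ≫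
        inv (huComplexTruncπ 𝒳 (p : ℤ) r M N) := by
    rw [IsIso.inv_comp_eq, ← Category.assoc, IsIso.eq_comp_inv]
    exact (huComplexTruncπ_naturality_reduce 𝒳 (p : ℤ) r M h').symm
  have key2 : stupidTruncLEMap (huComplexIntπ 𝒳 (p : ℤ) r M N') ((r : ℤ) - 1) ≫
      inv (huComplexTruncπ 𝒳 (p : ℤ) r M N') ≫ huComplexIntReduce 𝒳 (p : ℤ) r M h' =
      stupidTruncLEMap (huComplexIntπ 𝒳 (p : ℤ) r M N) ((r : ℤ) - 1) ≫
        inv (huComplexTruncπ 𝒳 (p : ℤ) r M N) := by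
    rw [key, ← Category.assoc]
    congr 1
    show HomologicalComplex.stupidTruncMap _ _ ≫ HomologicalComplex.stupidTruncMap _ _ = _
    rw [← HomologicalComplex.stupidTruncMap_comp, huComplexIntπ_comp_huComplexIntReduce]
  simp only [AddMonoidHom.coe_comp, Function.comp_apply]
  rw [← HyperExt.map_comp, ← HyperExt.map_comp, ← HyperExt.map_comp, key2]

/-- A family compatible under the one-step reductions is compatible under all reductions.
[folklore] -/
theorem huH_family_compatible (r m : ℕ) (i : ℤ) (o : ∀ N : ℕ, huH p k 𝒳 r m (N + 2) i)
    (ho : ∀ N, huHReduce p k 𝒳 r m (Nat.le_succ (N + 2)) i (o (N + 1)) = o N) (N t : ℕ) :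
    huHReduce p k 𝒳 r m (show N + 2 ≤ N + t + 2 by omega) i (o (N + t)) = o N := by
  induction t with
  | zero => exact huHReduce_refl p k 𝒳 r m (N + 2) i (o N)
  | succ t ih =>
    show huHReduce p k 𝒳 r m (show N + 2 ≤ N + t + 1 + 2 by omega) i (o (N + t + 1)) = o N
    rw [← ih, ← ho (N + t), huHReduce_comp]

/-! ### (L1): surjectivity of Hu's reductions -/

/-- **Hu's reductions are onto from torsion-freeness**: if `ℍʲ(σ≤(r-1) p^{(r-•)N}Ω•)` has no
`p`-torsion (`i + 1 = j`, `M ≤ N ≤ N'`), then `ℍⁱ(p^{r,M}_{r,N'}Ω•) → ℍⁱ(p^{r,M}_{r,N}Ω•)` is surjective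
(both are quotients of `ℍⁱ(σ≤ p^{(r-•)M}Ω•)`). [folklore] -/
theorem huHReduce_surjective_of_torsionFree (r : ℕ) {M N N' : ℕ} (h : M ≤ N) (h' : N ≤ N')
    (i j : ℤ) (hij : i + 1 = j) (htf : ∀ x : staircaseH p k 𝒳 r N j, (p : ℤ) • x = 0 → x = 0) :
    Function.Surjective (huHReduce p k 𝒳 r M h' i) := by
  intro y
  obtain ⟨u, rfl⟩ := staircaseHπ_surjective_of_torsionFree p k 𝒳 r h i j hij htf y
  exact ⟨staircaseHπ p k 𝒳 r M N' i u, huHReduce_staircaseHπ p k 𝒳 r M h' i u⟩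

/-- **(L1) from torsion-freeness.** If every `ℍ^{2r}(σ≤(r-1) p^{(r-•)(N+2)}Ω•)` (`1 ≤ r < p`, `N ≥ 0`)
has no `p`-torsion, then the transitions `⊕_{r<p} ℍ^{2r-1}(p^{r,1}_{r,N+3}Ω•) → ⊕_{r<p}
ℍ^{2r-1}(p^{r,1}_{r,N+2}Ω•)` (`HuKernelSource.reduce 1 (Nat.le_succ (N + 2))`) are surjective — the
hypothesis `hL1` of `kernelTower_of_huKernelPresentation` (Summits, line `hu`), verbatim.
[folklore] -/
theorem huKernelSource_reduce_surjective_of_torsionFree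
    (htf : ∀ (r : ℕ), 1 ≤ r → r < p → ∀ (N : ℕ) (x : staircaseH p k 𝒳 r (N + 2) (2 * (r : ℤ))),
      (p : ℤ) • x = 0 → x = 0) :
    ∀ N : ℕ, Function.Surjective
      (HuKernelSource.reduce (p := p) (k := k) (𝒳 := 𝒳) 1 (Nat.le_succ (N + 2))) := by
  intro N y
  have hs : ∀ r : {r : ℕ // 1 ≤ r ∧ r < p}, ∃ x : huH p k 𝒳 r.1 1 (N + 3) (2 * (r.1 : ℤ) - 1),
      huHReduce p k 𝒳 r.1 1 (Nat.le_succ (N + 2)) _ x = y r := fun r ↦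
    huHReduce_surjective_of_torsionFree p k 𝒳 r.1 (show 1 ≤ N + 2 by omega) (Nat.le_succ (N + 2))
      (2 * (r.1 : ℤ) - 1) (2 * (r.1 : ℤ)) (by omega) (htf r.1 r.2.1 r.2.2 N) (y r)
  choose x hx using hs
  exact ⟨x, funext fun r ↦ hx r⟩

/-- **(L1) from torsion-freeness in low weights and surjectivity in high weights.** The same with
the range of `r` split at `d`: torsion-freeness of `ℍ^{2r}(σ≤(r-1) p^{(r-•)(N+2)}Ω•)` for `1 ≤ r < d`
(columns `𝒪, …, Ω^{d-2}`), and for `d ≤ r < p` the surjectivity of Hu's reductions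
`ℍ^{2r-1}(p^{r,1}_{r,N+3}) → ℍ^{2r-1}(p^{r,1}_{r,N+2})` taken as a hypothesis (there the groups vanish
for `r > d`, and for `r = d` the reduction is a top-degree map, by the support of Hu's complexes on
the special fibre — `Crystalline/HuComplexesHighWeight`). [folklore] -/
theorem huKernelSource_reduce_surjective_of_torsionFree_of_high (d : ℕ)
    (htf : ∀ (r : ℕ), 1 ≤ r → r < d → ∀ (N : ℕ) (x : staircaseH p k 𝒳 r (N + 2) (2 * (r : ℤ))),
      (p : ℤ) • x = 0 → x = 0)
    (hhigh : ∀ (r : ℕ), d ≤ r → r < p → ∀ N : ℕ,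
      Function.Surjective (huHReduce p k 𝒳 r 1 (Nat.le_succ (N + 2)) (2 * (r : ℤ) - 1))) :
    ∀ N : ℕ, Function.Surjective
      (HuKernelSource.reduce (p := p) (k := k) (𝒳 := 𝒳) 1 (Nat.le_succ (N + 2))) := by
  intro N y
  have hs : ∀ r : {r : ℕ // 1 ≤ r ∧ r < p}, ∃ x : huH p k 𝒳 r.1 1 (N + 3) (2 * (r.1 : ℤ) - 1),
      huHReduce p k 𝒳 r.1 1 (Nat.le_succ (N + 2)) _ x = y r := fun r ↦ by
    by_cases hrd : r.1 < d
    · exact huHReduce_surjective_of_torsionFree p k 𝒳 r.1 (show 1 ≤ N + 2 by omega)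
        (Nat.le_succ (N + 2)) (2 * (r.1 : ℤ) - 1) (2 * (r.1 : ℤ)) (by omega) (htf r.1 r.2.1 hrd N) (y r)
    · exact hhigh r.1 (le_of_not_gt hrd) r.2.2 N (y r)
  choose x hx using hs
  exact ⟨x, funext fun r ↦ hx r⟩

/-! ### (L2): compatible families killed by an integer vanish -/

/-- **One tower: compatible families killed by a non-zero integer vanish.** Fix `r` and suppose:
(i) `H = ℍⁱ(σ≤(r-1) p^{(r-•)}Ω•)` has no `p`-torsion; (ii) every projection
`π_N : H → ℍⁱ(p^{r,1}_{r,N+2}Ω•)` is onto (e.g. by `staircaseHπ_surjective_of_torsionFree`); (iii) the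
image `I_{N+2}` of `ℍⁱ(σ≤ p^{(r-•)(N+2)}) → H` is divisible by `p^{N+1}`. Then a family
`o_N ∈ ℍⁱ(p^{r,1}_{r,N+2}Ω•)` compatible under Hu's reductions with `L • o_N = 0` for all `N` (`L ≠ 0`)
vanishes: writing `L = pᵃ L'` (`p ∤ L'`), `o_{N'} = π(u)` with `L u ∈ I_{N'+2} ⊆ p^{N'+1} H` gives
`u ∈ p^{N'+1-a} H` (Bézout, then cancelling `pᵃ` in the torsion-free `H`), and for
`N' = a + r(N+2) + N` this lies in `p^{r(N+2)} H ⊆ I_{N+2}` (`incl ∘ μ = p^{r(N+2)}`), so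
`o_N = reduce(o_{N'}) = π_N(u) = 0`. [folklore] -/
theorem huH_family_eq_zero (r : ℕ) (i : ℤ)
    (htfH : ∀ x : staircaseH p k 𝒳 r 1 i, (p : ℤ) • x = 0 → x = 0)
    (hsurj : ∀ N : ℕ, Function.Surjective (staircaseHπ p k 𝒳 r 1 (N + 2) i))
    (hdiv : ∀ (N : ℕ) (x : staircaseH p k 𝒳 r (N + 2) i), ∃ y : staircaseH p k 𝒳 r 1 i,
      staircaseHLE p k 𝒳 r (show 1 ≤ N + 2 by omega) i x = ((p : ℤ) ^ (N + 1)) • y)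
    (L : ℤ) (hL : L ≠ 0) (o : ∀ N : ℕ, huH p k 𝒳 r 1 (N + 2) i)
    (ho : ∀ N, huHReduce p k 𝒳 r 1 (Nat.le_succ (N + 2)) i (o (N + 1)) = o N)
    (hLo : ∀ N, L • o N = 0) (N : ℕ) : o N = 0 := by
  have hp : p.Prime := Fact.out
  obtain ⟨a, L', rfl, hL'⟩ := exists_eq_pow_mul_not_dvd hp hL
  -- the far level `N' = N + t`, `t = a + r (N + 2)`
  set t : ℕ := a + r * (N + 2) with ht
  obtain ⟨u, hu⟩ := hsurj (N + t) (o (N + t))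
  -- `L • u` dies under `π`, hence comes from level `N + t + 2`
  have hLu : staircaseHπ p k 𝒳 r 1 (N + t + 2) i (((p : ℤ) ^ a * L') • u) = 0 := by
    rw [map_zsmul, hu, hLo]
  obtain ⟨x, hx⟩ := ((exact_staircaseHLE_staircaseHπ p k 𝒳 r (show 1 ≤ N + t + 2 by omega) i) _).mp hLu
  obtain ⟨y, hy⟩ := hdiv (N + t) x
  -- `L' • (pᵃ • u) ∈ p^{N+t+1} H`, so `pᵃ • u ∈ p^{N+t+1} H` (Bézout)
  have h1 : ∃ y' : staircaseH p k 𝒳 r 1 i, ((p : ℤ) ^ a) • u = ((p : ℤ) ^ (N + t + 1)) • y' := by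
    refine mem_pow_smul_of_not_dvd_of_zsmul_mem hp hL' ⟨y, ?_⟩
    rw [smul_smul, mul_comm, ← hy, hx]
  -- cancel `pᵃ`: `u ∈ p^{N + 1 + r (N + 2)} H`
  have h2 : ∃ y' : staircaseH p k 𝒳 r 1 i, u = ((p : ℤ) ^ (N + 1 + r * (N + 2))) • y' := by
    refine mem_pow_smul_of_pow_zsmul_mem htfH (a := a) ?_
    obtain ⟨y', hy'⟩ := h1
    exact ⟨y', by rw [hy', ht]; congr 2; ring⟩
  obtain ⟨y', rfl⟩ := h2
  -- `p^{r(N+2)} H ⊆ im(incl)`, so `π_{N+2} u = 0`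
  have h3 : staircaseHπ p k 𝒳 r 1 (N + 2) i (((p : ℤ) ^ (N + 1 + r * (N + 2))) • y') = 0 := by
    rw [pow_add, mul_comm, mul_smul, ← staircaseHLE_staircaseHμ p k 𝒳 r (show 1 ≤ N + 2 by omega) i,
      staircaseHπ_staircaseHLE]
  -- descend from level `N + t` to level `N`
  rw [← huH_family_compatible p k 𝒳 r 1 i o ho N t, ← hu, huHReduce_staircaseHπ, h3]

/-- **(L2) from torsion-freeness and divisibility.** For `1 ≤ r < d` suppose: (i)
`ℍ^{2r}(σ≤(r-1) p^{(r-•)}Ω•)` has no `p`-torsion; (ii) every `ℍ^{2r+1}(σ≤(r-1) p^{(r-•)(N+2)}Ω•)` has no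
`p`-torsion; (iii) the image of `ℍ^{2r}(σ≤ p^{(r-•)(N+2)}Ω•) → ℍ^{2r}(σ≤ p^{(r-•)}Ω•)` is divisible by
`p^{N+1}`. Then on the tower `N ↦ ⊕_{r<d} ℍ^{2r}(p^{r,1}_{r,N+2}Ω•)` every family compatible under
`HuObstructionTarget.reduce d 1 (Nat.le_succ (N + 2))` and killed by a non-zero integer vanishes —
the hypothesis `hL2` of `levelwiseClassLift_of_huLiftingCriterion` (Summits, line `hu`), verbatim.
[folklore] -/
theorem huObstructionTarget_family_eq_zero (d : ℕ)
    (htfH : ∀ (r : ℕ), 1 ≤ r → r < d → ∀ x : staircaseH p k 𝒳 r 1 (2 * (r : ℤ)),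
      (p : ℤ) • x = 0 → x = 0)
    (htf1 : ∀ (r : ℕ), 1 ≤ r → r < d → ∀ (N : ℕ) (x : staircaseH p k 𝒳 r (N + 2) (2 * (r : ℤ) + 1)),
      (p : ℤ) • x = 0 → x = 0)
    (hdiv : ∀ (r : ℕ), 1 ≤ r → r < d → ∀ (N : ℕ) (x : staircaseH p k 𝒳 r (N + 2) (2 * (r : ℤ))),
      ∃ y : staircaseH p k 𝒳 r 1 (2 * (r : ℤ)),
        staircaseHLE p k 𝒳 r (show 1 ≤ N + 2 by omega) _ x = ((p : ℤ) ^ (N + 1)) • y) :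
    ∀ (L : ℤ), L ≠ 0 → ∀ o : (∀ N : ℕ, HuObstructionTarget p k 𝒳 d 1 (N + 2)),
      (∀ N, HuObstructionTarget.reduce d 1 (Nat.le_succ (N + 2)) (o (N + 1)) = o N) →
      (∀ N, L • o N = 0) → ∀ N, o N = 0 := by
  intro L hL o ho hLo N
  funext rr
  obtain ⟨r, hr1, hrd⟩ := rr
  exact huH_family_eq_zero p k 𝒳 r (2 * (r : ℤ)) (htfH r hr1 hrd)
    (fun N' ↦ staircaseHπ_surjective_of_torsionFree p k 𝒳 r (show 1 ≤ N' + 2 by omega)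
      (2 * (r : ℤ)) (2 * (r : ℤ) + 1) rfl (htf1 r hr1 hrd N'))
    (hdiv r hr1 hrd) L hL (fun N' ↦ o N' ⟨r, hr1, hrd⟩) (fun N' ↦ congrFun (ho N') ⟨r, hr1, hrd⟩)
    (fun N' ↦ congrFun (hLo N') ⟨r, hr1, hrd⟩) N

end Staircase

end Literature.AlgebraicGeometry.KTheory.HuStaircase

end
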